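import Literature.AlgebraicGeometry.Motives.AbelianVarietyTwoSmulSectionsCover
import Literature.AlgebraicGeometry.Motives.AbelianVarietyFiniteOfFibreTranslate
import Literature.AlgebraicGeometry.Motives.AbelianVarietyTranslationLemma
import Literature.AlgebraicGeometry.Motives.AbelianVarietyKThetaOfTranslationSupport
import Literature.AlgebraicGeometry.Motives.CartierDivisorMultipleEffective
import HarnessLib

/-!
# Mumford §6 Application 1, (ii) ⇒ (iv): an effective divisor with finite stabiliser is ample — ASSEMBLED (road G5, (V7-c))

Mumford, *Abelian Varieties*, §6 Application 1 (pp. 60–61): for an effective divisor `D` on an abelian variety `A` over `k = k̄`,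
if only finitely many `x ∈ A(k)` satisfy `t_x^*D ∼ D` (or merely: only finitely many translations stabilise `Supp D` as a SET),
then `D` is ample.  PROOF = linear-system half (★ `Motives/AbelianVarietyTwoSmulSectionsCover`: the sections `s_y ∈ Γ(2D)` of the
theorem of the square cover `A`; finitely many give `φ : A → ℙᴺ` proper with each fibre inside a translate of `A ∖ Supp D`; `φ`
finite ⇒ `D` ample) + finiteness half ((F) `Motives/AbelianVarietyFiniteOfFibreTranslate`: such a `φ` is finite, granted Mumford's
translation lemma (H) «an irreducible closed `Z ⊆ t_y⁻¹(A ∖ Supp D)` has `t_{zz′⁻¹}(Supp D) = Supp D` for `z, z′ ∈ Z(k)`» and the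
finiteness of the set-stabiliser).  This file is the 3-line junction; (H) enters as the hypothesis `hH` exactly as in (F)
(`Motives/AbelianVarietyTranslationLemma`, (V7-c-ii), discharges it by name).

THEOREMS ONLY (no definition, no named fact, no `sorry`).  COUNT-NEUTRAL capital on the road G5 to row VI-7 (F-R) of the cell
`hodgecm-mathlib` (D-0151; crux HLiu418 = stmt-HodgeConjecture-24832): with `D := Θ_W` the prime theta divisor (★
`JacobianPrimeThetaDivisorExists`) and `K(Θ_W) = ⊥` (★ `JacobianThetaKThetaTrivialOfMultOne`) it yields «`Θ_W` is ample», the last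
input of `riemann_brillNoetherLocus_isPrincipalPolarizationDivisor`.  HC_CM is proved only modulo the 7 printed citations until
rung 0 closes.

## References
* [MumfordAV1970] D. Mumford, *Abelian Varieties* (1970), §6 Application 1 and its proof (pp. 60–61).
-/

noncomputable section

open CategoryTheory AlgebraicGeometry TopologicalSpace

universe u

namespace Literature.AlgebraicGeometry.Motives

namespace AbelianVariety

variable {k : Type u} [Field k] [IsAlgClosed k] (A : AbelianVariety k) {D : CartierDivisor A.X.left}

/-- **Mumford §6 Application 1, (ii) ⇒ (iv), granted the translation lemma (H)**: an EFFECTIVE divisor `D` on the abelian variety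
`A` over `k = k̄` such that only finitely many `x ∈ A(k)` have `t_x(Supp D) = Supp D` is AMPLE.  (Linear-system half ★
`isAmple_of_isEffective_of_forall_isFinite` ∘ finiteness half `isFinite_of_preimage_subset_translate_of_translationLemma`.)
[cite: MumfordAV1970, §6 Application 1 and its proof (pp. 60–61)] -/
theorem isAmple_of_isEffective_of_finite_stabilizer_of_translationLemma
    (hH : ∀ (Z : Set A.X.left), IsClosed Z → IsIrreducible Z → ∀ (y : A.Points k),
      Z ⊆ (A.translation y).left.base ⁻¹' (D.nonvanishing 1) → ∀ (z z' : A.Points k), z.pt ∈ Z → z'.pt ∈ Z →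
        (A.translation (z * z'⁻¹)).left.base '' (D.nonvanishing 1)ᶜ = (D.nonvanishing 1)ᶜ)
    (hD : D.IsEffective)
    (hstab : {x : A.Points k | (A.translation x).left.base '' (D.nonvanishing 1)ᶜ = (D.nonvanishing 1)ᶜ}.Finite) :
    D.IsAmple :=
  A.isAmple_of_isEffective_of_forall_isFinite hD fun _ φ _ _ hcov =>
    A.isFinite_of_preimage_subset_translate_of_translationLemma D hH hstab φ hcov

/-- **Mumford §6 Application 1, (ii) ⇒ (iv), `K(D)` finite**, granted (H) and the transfer «set-stabiliser ⇒ `K(D)`» `hT` of the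
translation-lemma file. [cite: MumfordAV1970, §6 Application 1 and its proof (pp. 60–61)] -/
theorem isAmple_of_isEffective_of_finite_KTheta_of_lemmas
    (hH : ∀ (Z : Set A.X.left), IsClosed Z → IsIrreducible Z → ∀ (y : A.Points k),
      Z ⊆ (A.translation y).left.base ⁻¹' (D.nonvanishing 1) → ∀ (z z' : A.Points k), z.pt ∈ Z → z'.pt ∈ Z →
        (A.translation (z * z'⁻¹)).left.base '' (D.nonvanishing 1)ᶜ = (D.nonvanishing 1)ᶜ)
    (hT : ∀ x : A.Points k, (A.translation x).left.base '' (D.nonvanishing 1)ᶜ = (D.nonvanishing 1)ᶜ → x ∈ A.KTheta D)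
    (hD : D.IsEffective) (hK : (A.KTheta D : Set (A.Points k)).Finite) : D.IsAmple :=
  A.isAmple_of_isEffective_of_forall_isFinite hD fun _ φ _ _ hcov =>
    A.isFinite_of_preimage_subset_translate_of_finite_KTheta_of_lemmas D hH hT hK φ hcov

/-- **Mumford §6 Application 1, (ii) ⇒ (iv), `K(D) = ⊥` spelling** (the shape the G5 socket `stub_V7c` carries: `Θ_W` effective with
`K(Θ_W) = ⊥` is ample), granted (H) and `hT`. [cite: MumfordAV1970, §6 Application 1 and its proof (pp. 60–61)] -/
theorem isAmple_of_isEffective_of_KTheta_eq_bot_of_lemmas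
    (hH : ∀ (Z : Set A.X.left), IsClosed Z → IsIrreducible Z → ∀ (y : A.Points k),
      Z ⊆ (A.translation y).left.base ⁻¹' (D.nonvanishing 1) → ∀ (z z' : A.Points k), z.pt ∈ Z → z'.pt ∈ Z →
        (A.translation (z * z'⁻¹)).left.base '' (D.nonvanishing 1)ᶜ = (D.nonvanishing 1)ᶜ)
    (hT : ∀ x : A.Points k, (A.translation x).left.base '' (D.nonvanishing 1)ᶜ = (D.nonvanishing 1)ᶜ → x ∈ A.KTheta D)
    (hD : D.IsEffective) (hK : A.KTheta D = ⊥) : D.IsAmple :=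
  A.isAmple_of_isEffective_of_forall_isFinite hD fun _ φ _ _ hcov =>
    A.isFinite_of_preimage_subset_translate_of_KTheta_eq_bot_of_lemmas D hH hT hK φ hcov

/-! ## EDITION 2 — UNCONDITIONAL: the translation lemma (H) ★ `AbelianVarietyTranslationLemma` and the transfer (T) ★
`AbelianVarietyKThetaOfTranslationSupport` discharge `hH`, `hT` (irreducible support) -/

/-- **Mumford §6 Application 1, (ii) ⇒ (iv), UNCONDITIONAL, set-stabiliser form**: an effective divisor with IRREDUCIBLE support on an
abelian variety over `k = k̄` such that only finitely many `x ∈ A(k)` satisfy `t_x(Supp D) = Supp D` is AMPLE (★ (H)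
`image_translation_support_eq_of_subset_preimage`). [cite: MumfordAV1970, §6 Application 1 and its proof (pp. 60–61)] -/
theorem isAmple_of_isEffective_of_finite_stabilizer (hD : D.IsEffective) (hirr : IsIrreducible (D.nonvanishing 1)ᶜ)
    (hstab : {x : A.Points k | (A.translation x).left.base '' (D.nonvanishing 1)ᶜ = (D.nonvanishing 1)ᶜ}.Finite) :
    D.IsAmple :=
  A.isAmple_of_isEffective_of_finite_stabilizer_of_translationLemma
    (fun _ hZc hZi y hy _ _ hz hz' => A.image_translation_support_eq_of_subset_preimage hD hirr hZc hZi y hy hz hz') hD hstab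

/-- **Mumford §6 Application 1, (ii) ⇒ (iv), `K(D)` finite** — irreducible support and «multiplicity one» `hone` (no `D = m•E`, `m ≥ 2`;
e.g. `Z(D)` reduced, ★ `forall_eq_one_of_isReduced`) so that set-stabilisers lie in `K(D)` (★ (T)
`mem_KTheta_of_image_translation_support_eq`). [cite: MumfordAV1970, §6 Application 1 and its proof (pp. 60–61)] -/
theorem isAmple_of_isEffective_of_finite_KTheta (hD : D.IsEffective) (hirr : IsIrreducible (D.nonvanishing 1)ᶜ)
    (hone : ∀ (E : CartierDivisor A.X.left) (m : ℕ), E.IsEffective → 0 < m → D.SameDivisor (m • E) → m = 1)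
    (hK : (A.KTheta D : Set (A.Points k)).Finite) : D.IsAmple :=
  A.isAmple_of_isEffective_of_finite_KTheta_of_lemmas
    (fun _ hZc hZi y hy _ _ hz hz' => A.image_translation_support_eq_of_subset_preimage hD hirr hZc hZi y hy hz hz')
    (fun _ hx => A.mem_KTheta_of_image_translation_support_eq hD hirr hone hx) hD hK

/-- **Mumford §6 Application 1, (ii) ⇒ (iv), `K(D) = ⊥` spelling** (irreducible support, multiplicity one): the G5 socket `stub_V7c` for the
prime theta divisor `Θ_W` with ★ `KTheta Θ_W = ⊥`. [cite: MumfordAV1970, §6 Application 1 and its proof (pp. 60–61)] -/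
theorem isAmple_of_isEffective_of_KTheta_eq_bot (hD : D.IsEffective) (hirr : IsIrreducible (D.nonvanishing 1)ᶜ)
    (hone : ∀ (E : CartierDivisor A.X.left) (m : ℕ), E.IsEffective → 0 < m → D.SameDivisor (m • E) → m = 1)
    (hK : A.KTheta D = ⊥) : D.IsAmple :=
  A.isAmple_of_isEffective_of_KTheta_eq_bot_of_lemmas
    (fun _ hZc hZi y hy _ _ hz hz' => A.image_translation_support_eq_of_subset_preimage hD hirr hZc hZi y hy hz hz')
    (fun _ hx => A.mem_KTheta_of_image_translation_support_eq hD hirr hone hx) hD hK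

/-- **Mumford §6 Application 1, (ii) ⇒ (iv), for a REDUCED irreducible divisor**: `Z(D)` reduced (e.g. the prime theta divisor) and
`K(D) = ⊥` ⇒ `D` ample; multiplicity one from ★ `CartierDivisor.IsEffective.forall_eq_one_of_isReduced` on the regular `A`.
[cite: MumfordAV1970, §6 Application 1 and its proof (pp. 60–61)] -/
theorem isAmple_of_isEffective_of_KTheta_eq_bot_of_isReduced (hD : D.IsEffective) [IsReduced hD.idealSheaf.subscheme]
    (hirr : IsIrreducible (D.nonvanishing 1)ᶜ) (hK : A.KTheta D = ⊥) : D.IsAmple :=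
  haveI := A.isNoetherian_left
  A.isAmple_of_isEffective_of_KTheta_eq_bot hD hirr
    (fun E m _ hm h => hD.forall_eq_one_of_isReduced (fun x => A.isRegularLocalRing_stalk x) hirr E m hm h) hK

end AbelianVariety

end Literature.AlgebraicGeometry.Motives

end
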